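import Literature.Combinatorics.StablePolynomials.DiskStabilityPreservers
import HarnessLib

/-!
# Asano contractions preserve `𝔻`-stability (Borcea–Brändén II, Lemma 8.8)

J. Borcea, P. Brändén, *The Lee–Yang and Pólya–Schur programs. II.*, Comm. Pure Appl. Math. 62 (2009)
1595–1631 (arXiv:0809.3087), §8.3:

> Let `f(z_1,…,z_n) = a(z_3,…,z_n) + b(z_3,…,z_n) z_1 + c(z_3,…,z_n) z_2 + d(z_3,…,z_n) z_1z_2` be a polynomial
> in `n ≥ 2` variables which is multi-affine in `z_1` and `z_2`. The Asano contraction of `f` is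
> `A(f)(z_1,…,z_n) = a(z_3,…,z_n) + d(z_3,…,z_n) z_1`. …
>
> **Lemma 8.8.** Let `κ = (κ_1,…,κ_n) ∈ ℕⁿ` with `n ≥ 2` and `κ_1 = κ_2 = 1`. Then
> `A : ℂ_κ[z_1,…,z_n] → ℂ_κ[z_1,…,z_n]` is a linear operator that preserves `𝔻`-stability.
>
> *Proof.* It is clear that `A` is linear. Its (algebraic) symbol is
> `A[(1+zw)^κ] = (1+zw)^{(κ_3,…,κ_n)} (1 + z_1w_1w_2)`, which is `𝔻`-stable, so the assertion follows from
> Theorem 3.2.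

`A` is realised as the linear map `asanoContraction i₁ i₂` on all of `ℂ[z]` (`z^s ↦ z^{s - s_{i₂}e_{i₂}}` if
`s_{i₁} = s_{i₂}`, `0` otherwise), which is the displayed contraction on polynomials multi-affine in `z_{i₁}, z_{i₂}`
(`asanoContraction_eq`). The symbol is computed through the evaluation formula
`A(f)(z) = f|_{0,0} + z_{i₁}(f|_{1,1} - f|_{1,0} - f|_{0,1} + f|_{0,0})` (`eval_asanoContraction`), and Theorem 3.2
(`C = 𝔻`, `BorceaBranden_diskStabilityPreserver_iff`) gives the lemma; `A(f) ≠ 0` because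
`A(f)(0, ·) = f(0, 0, ·)`.

## Contents

* §1 `asanoContraction`, `asanoContraction_monomial`, `asanoContraction_eq` (`A(a + bz_1 + cz_2 + dz_1z_2) = a + dz_1`).
* §2 `eval_update_update_monomial`, `eval_asanoContraction_monomial`, **`eval_asanoContraction`**.
* §3 `degreeOf_prod_one_add_C_mul_X_pow_le`, **`eval_asanoContraction_symbol`** (`A[(1+zw)^κ]`),
  `isDiskStable_boundedDegreeSymbolD_asanoContraction`, **`asano_contraction_diskStable`** (Lemma 8.8).

## References

* [BorceaBranden2009II] J. Borcea, P. Brändén, Comm. Pure Appl. Math. 62 (2009) 1595–1631, §8.3 Lemma 8.8.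
-/

noncomputable section

open MvPolynomial Finset

namespace Literature.Combinatorics.StablePolynomials

variable {σ : Type*} [Fintype σ] [DecidableEq σ]

/-! ## §1 The Asano contraction as a linear operator -/

section Def

/-- **The Asano contraction** with respect to the variables `z_{i₁}` ("`z_1`") and `z_{i₂}` ("`z_2`"): the linear
map `z^s ↦ z^{s ∖ i₂}` if `s_{i₁} = s_{i₂}` and `z^s ↦ 0` otherwise; on
`f = a + b z_{i₁} + c z_{i₂} + d z_{i₁}z_{i₂}` it is `A(f) = a + d z_{i₁}` (`asanoContraction_eq`).
[cite: BorceaBranden2009II, §8.3 (definition of `A(f)`)] -/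
def asanoContraction (i₁ i₂ : σ) : MvPolynomial σ ℂ →ₗ[ℂ] MvPolynomial σ ℂ :=
  (basisMonomials σ ℂ).constr ℂ fun s => if s i₁ = s i₂ then monomial (s.erase i₂) (1 : ℂ) else 0

omit [Fintype σ] [DecidableEq σ] in
/-- `A` on a monomial. [cite: BorceaBranden2009II, §8.3 (definition of `A(f)`)] -/
theorem asanoContraction_monomial (i₁ i₂ : σ) (s : σ →₀ ℕ) (c : ℂ) :
    asanoContraction i₁ i₂ (monomial s c) = if s i₁ = s i₂ then monomial (s.erase i₂) c else 0 := by
  have h : (monomial s c : MvPolynomial σ ℂ) = c • basisMonomials σ ℂ s := by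
    rw [coe_basisMonomials, smul_monomial, smul_eq_mul, mul_one]
  rw [h, map_smul, asanoContraction, Module.Basis.constr_basis]
  split_ifs
  · rw [smul_monomial, smul_eq_mul, mul_one]
  · rw [smul_zero]

omit [Fintype σ] [DecidableEq σ] in
/-- A polynomial not involving `z_i` is a sum of monomials with `s_i = 0`. [folklore] -/
private theorem exp_eq_zero_of_degreeOf_eq_zero {p : MvPolynomial σ ℂ} {i : σ} (h : degreeOf i p = 0)
    {s : σ →₀ ℕ} (hs : s ∈ p.support) : s i = 0 :=
  Nat.le_zero.1 (h ▸ monomial_le_degreeOf i hs)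

omit [Fintype σ] in
/-- **`A(a + b z_1 + c z_2 + d z_1z_2) = a + d z_1`** for `a, b, c, d` not involving `z_1, z_2`: the tree's operator
is the printed Asano contraction. [cite: BorceaBranden2009II, §8.3 (definition of `A(f)`)] -/
theorem asanoContraction_eq {i₁ i₂ : σ} (h12 : i₁ ≠ i₂) {a b c d : MvPolynomial σ ℂ}
    (ha₁ : degreeOf i₁ a = 0) (ha₂ : degreeOf i₂ a = 0) (hb₁ : degreeOf i₁ b = 0) (hb₂ : degreeOf i₂ b = 0)
    (hc₁ : degreeOf i₁ c = 0) (hc₂ : degreeOf i₂ c = 0) (hd₁ : degreeOf i₁ d = 0) (hd₂ : degreeOf i₂ d = 0) :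
    asanoContraction i₁ i₂ (a + b * X i₁ + c * X i₂ + d * (X i₁ * X i₂)) = a + d * X i₁ := by
  set A := asanoContraction i₁ i₂ with hA
  -- `A a = a`
  have hAa : A a = a := by
    conv_lhs => rw [a.as_sum]
    conv_rhs => rw [a.as_sum]
    rw [map_sum]
    refine sum_congr rfl fun s hs => ?_
    rw [hA, asanoContraction_monomial, if_pos (by rw [exp_eq_zero_of_degreeOf_eq_zero ha₁ hs,
      exp_eq_zero_of_degreeOf_eq_zero ha₂ hs]), Finsupp.erase_of_notMem_support]
    exact Finsupp.notMem_support_iff.2 (exp_eq_zero_of_degreeOf_eq_zero ha₂ hs)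
  -- `A (b z_1) = 0`, `A (c z_2) = 0`
  have hAb : A (b * X i₁) = 0 := by
    conv_lhs => rw [b.as_sum]
    rw [sum_mul, map_sum]
    refine sum_eq_zero fun s hs => ?_
    rw [X, monomial_mul, mul_one, hA, asanoContraction_monomial, if_neg]
    rw [Finsupp.add_apply, Finsupp.add_apply, Finsupp.single_eq_same, Finsupp.single_eq_of_ne h12.symm,
      exp_eq_zero_of_degreeOf_eq_zero hb₁ hs, exp_eq_zero_of_degreeOf_eq_zero hb₂ hs]
    decide
  have hAc : A (c * X i₂) = 0 := by
    conv_lhs => rw [c.as_sum]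
    rw [sum_mul, map_sum]
    refine sum_eq_zero fun s hs => ?_
    rw [X, monomial_mul, mul_one, hA, asanoContraction_monomial, if_neg]
    rw [Finsupp.add_apply, Finsupp.add_apply, Finsupp.single_eq_same, Finsupp.single_eq_of_ne h12,
      exp_eq_zero_of_degreeOf_eq_zero hc₁ hs, exp_eq_zero_of_degreeOf_eq_zero hc₂ hs]
    decide
  -- `A (d z_1 z_2) = d z_1`
  have hAd : A (d * (X i₁ * X i₂)) = d * X i₁ := by
    conv_lhs => rw [d.as_sum]
    conv_rhs => rw [d.as_sum]
    rw [sum_mul, sum_mul, map_sum]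
    refine sum_congr rfl fun s hs => ?_
    have hs₁ := exp_eq_zero_of_degreeOf_eq_zero hd₁ hs
    have hs₂ := exp_eq_zero_of_degreeOf_eq_zero hd₂ hs
    rw [X, X, monomial_mul, monomial_mul, monomial_mul]
    simp only [mul_one]
    have hexp : Finsupp.erase i₂ (s + (Finsupp.single i₁ 1 + Finsupp.single i₂ 1)) = s + Finsupp.single i₁ 1 := by
      ext j
      by_cases hj : j = i₂
      · subst hj
        rw [Finsupp.erase_same]
        simp [h12, hs₂]
      · rw [Finsupp.erase_ne hj]
        simp [Finsupp.single_apply, hj]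
    rw [hA, asanoContraction_monomial, if_pos, hexp]
    simp [h12, h12.symm, hs₁, hs₂]
  rw [map_add, map_add, map_add, hAa, hAb, hAc, hAd, add_zero, add_zero]

end Def

/-! ## §2 The evaluation formula -/

section Eval

/-- `z^s` at a point with prescribed `z_{i₁} = a`, `z_{i₂} = b`:
`a^{s_{i₁}} b^{s_{i₂}} · c Π_{j ≠ i₁,i₂} z_j^{s_j}`. [cite: BorceaBranden2009II, §8.3 proof of Lemma 8.8] -/
theorem eval_update_update_monomial {i₁ i₂ : σ} (h12 : i₁ ≠ i₂) (z : σ → ℂ) (a b : ℂ) (s : σ →₀ ℕ)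
    (c : ℂ) :
    eval (Function.update (Function.update z i₂ b) i₁ a) (monomial s c) =
      a ^ s i₁ * b ^ s i₂ * (c * ∏ j ∈ (univ.erase i₁).erase i₂, z j ^ s j) := by
  rw [eval_monomial, Finsupp.prod_pow, ← Finset.mul_prod_erase univ _ (mem_univ i₁),
    ← Finset.mul_prod_erase (univ.erase i₁) _ (mem_erase.2 ⟨h12.symm, mem_univ i₂⟩),
    Function.update_self, Function.update_of_ne h12.symm, Function.update_self]
  have h : ∏ j ∈ (univ.erase i₁).erase i₂, Function.update (Function.update z i₂ b) i₁ a j ^ s j =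
      ∏ j ∈ (univ.erase i₁).erase i₂, z j ^ s j := by
    refine prod_congr rfl fun j hj => ?_
    have hj₂ : j ≠ i₂ := (mem_erase.1 hj).1
    have hj₁ : j ≠ i₁ := (mem_erase.1 (mem_erase.1 hj).2).1
    rw [Function.update_of_ne hj₁, Function.update_of_ne hj₂]
  rw [h]
  ring

/-- `A(z^s)` evaluated: `[s_{i₁} = s_{i₂}] z_{i₁}^{s_{i₁}} · c Π_{j ≠ i₁,i₂} z_j^{s_j}`.
[cite: BorceaBranden2009II, §8.3 proof of Lemma 8.8] -/
theorem eval_asanoContraction_monomial {i₁ i₂ : σ} (h12 : i₁ ≠ i₂) (z : σ → ℂ) (s : σ →₀ ℕ) (c : ℂ) :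
    eval z (asanoContraction i₁ i₂ (monomial s c)) =
      if s i₁ = s i₂ then z i₁ ^ s i₁ * (c * ∏ j ∈ (univ.erase i₁).erase i₂, z j ^ s j) else 0 := by
  rw [asanoContraction_monomial]
  split_ifs with h
  · rw [eval_monomial, Finsupp.prod_pow, ← Finset.mul_prod_erase univ _ (mem_univ i₁),
      ← Finset.mul_prod_erase (univ.erase i₁) _ (mem_erase.2 ⟨h12.symm, mem_univ i₂⟩),
      Finsupp.erase_ne h12, Finsupp.erase_same, pow_zero, one_mul]
    have h' : ∏ j ∈ (univ.erase i₁).erase i₂, z j ^ (s.erase i₂) j = ∏ j ∈ (univ.erase i₁).erase i₂, z j ^ s j :=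
      prod_congr rfl fun j hj => by rw [Finsupp.erase_ne (mem_erase.1 hj).1]
    rw [h']
    ring
  · rw [map_zero]

/-- **The evaluation formula**: for `f` multi-affine in `z_{i₁}, z_{i₂}`,
`A(f)(z) = f|_{0,0}(z) + z_{i₁} (f|_{1,1} - f|_{1,0} - f|_{0,1} + f|_{0,0})(z)`, where `f|_{a,b}` sets
`z_{i₁} = a`, `z_{i₂} = b` (for `f = a + bz_1 + cz_2 + dz_1z_2` this reads `a + d z_1`).
[cite: BorceaBranden2009II, §8.3 (definition of `A(f)`), proof of Lemma 8.8] -/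
theorem eval_asanoContraction {i₁ i₂ : σ} (h12 : i₁ ≠ i₂) {p : MvPolynomial σ ℂ} (h1 : degreeOf i₁ p ≤ 1)
    (h2 : degreeOf i₂ p ≤ 1) (z : σ → ℂ) :
    eval z (asanoContraction i₁ i₂ p) =
      eval (Function.update (Function.update z i₂ 0) i₁ 0) p +
        z i₁ * (eval (Function.update (Function.update z i₂ 1) i₁ 1) p -
          eval (Function.update (Function.update z i₂ 0) i₁ 1) p -
          eval (Function.update (Function.update z i₂ 1) i₁ 0) p +
          eval (Function.update (Function.update z i₂ 0) i₁ 0) p) := by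
  set E : ℂ → ℂ → ℂ := fun a b => eval (Function.update (Function.update z i₂ b) i₁ a) p with hE
  -- termwise identity over the support
  have key : ∀ s ∈ p.support, eval z (asanoContraction i₁ i₂ (monomial s (coeff s p))) =
      eval (Function.update (Function.update z i₂ 0) i₁ 0) (monomial s (coeff s p)) +
        z i₁ * (eval (Function.update (Function.update z i₂ 1) i₁ 1) (monomial s (coeff s p)) -
          eval (Function.update (Function.update z i₂ 0) i₁ 1) (monomial s (coeff s p)) -
          eval (Function.update (Function.update z i₂ 1) i₁ 0) (monomial s (coeff s p)) +
          eval (Function.update (Function.update z i₂ 0) i₁ 0) (monomial s (coeff s p))) := by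
    intro s hs
    have hs₁ : s i₁ ≤ 1 := (monomial_le_degreeOf i₁ hs).trans h1
    have hs₂ : s i₂ ≤ 1 := (monomial_le_degreeOf i₂ hs).trans h2
    rw [eval_asanoContraction_monomial h12, eval_update_update_monomial h12, eval_update_update_monomial h12,
      eval_update_update_monomial h12, eval_update_update_monomial h12]
    rcases Nat.le_one_iff_eq_zero_or_eq_one.1 hs₁ with e₁ | e₁ <;>
      rcases Nat.le_one_iff_eq_zero_or_eq_one.1 hs₂ with e₂ | e₂ <;> simp [e₁, e₂]
  have hsum : ∀ v : σ → ℂ, eval v p = ∑ s ∈ p.support, eval v (monomial s (coeff s p)) := fun v => by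
    conv_lhs => rw [p.as_sum]
    rw [map_sum]
  have hL : eval z (asanoContraction i₁ i₂ p) =
      ∑ s ∈ p.support, eval z (asanoContraction i₁ i₂ (monomial s (coeff s p))) := by
    conv_lhs => rw [p.as_sum]
    rw [map_sum, map_sum]
  rw [hL, sum_congr rfl key, sum_add_distrib, ← mul_sum, sum_add_distrib, sum_sub_distrib, sum_sub_distrib,
    ← hsum, ← hsum, ← hsum, ← hsum]

end Eval

/-! ## §3 The symbol and Lemma 8.8 -/

section Symbol

omit [DecidableEq σ] in
/-- `deg_{z_i} Π_j (1 + w_j z_j)^{κ_j} ≤ κ_i`. [cite: BorceaBranden2009II, §3 (`(1+zw)^κ ∈ ℂ_κ`)] -/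
theorem degreeOf_prod_one_add_C_mul_X_pow_le [DecidableEq σ] (κ : σ → ℕ) (w : σ → ℂ) (i : σ) :
    degreeOf i (∏ j, (1 + C (w j) * X j) ^ κ j : MvPolynomial σ ℂ) ≤ κ i := by
  refine (degreeOf_prod_le _ _ _).trans ?_
  calc ∑ j, degreeOf i ((1 + C (w j) * X j) ^ κ j : MvPolynomial σ ℂ)
      ≤ ∑ j, (if i = j then κ i else 0) := sum_le_sum fun j _ => ?_
    _ = κ i := by rw [sum_ite_eq, if_pos (mem_univ _)]
  have h1 : degreeOf i (1 + C (w j) * X j : MvPolynomial σ ℂ) ≤ if i = j then 1 else 0 := by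
    have h2 := degreeOf_C_mul_X_add_C_le (w j) (1 : ℂ) i j
    rwa [C_1, add_comm] at h2
  refine ((degreeOf_pow_le _ _ _).trans (Nat.mul_le_mul_left _ h1)).trans ?_
  split_ifs with h
  · subst h
    rw [mul_one]
  · simp

/-- `Π_j (1 + w_j z_j)^{κ_j}` at a point with `z_{i₁} = a`, `z_{i₂} = b` (`κ_{i₁} = κ_{i₂} = 1`).
[cite: BorceaBranden2009II, §8.3 proof of Lemma 8.8] -/
theorem eval_update_update_prod_one_add {i₁ i₂ : σ} (h12 : i₁ ≠ i₂) {κ : σ → ℕ} (hκ₁ : κ i₁ = 1)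
    (hκ₂ : κ i₂ = 1) (z w : σ → ℂ) (a b : ℂ) :
    eval (Function.update (Function.update z i₂ b) i₁ a) (∏ j, (1 + C (w j) * X j) ^ κ j : MvPolynomial σ ℂ) =
      (1 + w i₁ * a) * (1 + w i₂ * b) * ∏ j ∈ (univ.erase i₁).erase i₂, (1 + w j * z j) ^ κ j := by
  rw [_root_.map_prod, ← Finset.mul_prod_erase univ _ (mem_univ i₁),
    ← Finset.mul_prod_erase (univ.erase i₁) _ (mem_erase.2 ⟨h12.symm, mem_univ i₂⟩)]
  simp only [map_pow, map_add, map_one, map_mul, eval_C, eval_X, Function.update_self,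
    Function.update_of_ne h12.symm, hκ₁, hκ₂, pow_one]
  rw [mul_assoc]
  congr 2
  refine prod_congr rfl fun j hj => ?_
  rw [Function.update_of_ne (mem_erase.1 (mem_erase.1 hj).2).1, Function.update_of_ne (mem_erase.1 hj).1]

/-- **The symbol of the Asano contraction**: `A[Π_j(1+w_jz_j)^{κ_j}](z) = (1 + z_1w_1w_2) Π_{j≥3}(1+w_jz_j)^{κ_j}`
(`κ_1 = κ_2 = 1`). [cite: BorceaBranden2009II, §8.3 proof of Lemma 8.8
("`A[(1+zw)^κ] = (1+zw)^{(κ_3,…,κ_n)}(1+z_1w_1w_2)`")] -/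
theorem eval_asanoContraction_symbol {i₁ i₂ : σ} (h12 : i₁ ≠ i₂) {κ : σ → ℕ} (hκ₁ : κ i₁ = 1)
    (hκ₂ : κ i₂ = 1) (z w : σ → ℂ) :
    eval z (asanoContraction i₁ i₂ (∏ j, (1 + C (w j) * X j) ^ κ j)) =
      (1 + z i₁ * w i₁ * w i₂) * ∏ j ∈ (univ.erase i₁).erase i₂, (1 + w j * z j) ^ κ j := by
  rw [eval_asanoContraction h12 ((degreeOf_prod_one_add_C_mul_X_pow_le κ w i₁).trans hκ₁.le)
    ((degreeOf_prod_one_add_C_mul_X_pow_le κ w i₂).trans hκ₂.le),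
    eval_update_update_prod_one_add h12 hκ₁ hκ₂, eval_update_update_prod_one_add h12 hκ₁ hκ₂,
    eval_update_update_prod_one_add h12 hκ₁ hκ₂, eval_update_update_prod_one_add h12 hκ₁ hκ₂]
  ring

/-- **The symbol `A[(1+zw)^κ]` is `𝔻`-stable.** [cite: BorceaBranden2009II, §8.3 proof of Lemma 8.8] -/
theorem isDiskStable_boundedDegreeSymbolD_asanoContraction {i₁ i₂ : σ} (h12 : i₁ ≠ i₂) {κ : σ → ℕ}
    (hκ₁ : κ i₁ = 1) (hκ₂ : κ i₂ = 1) :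
    IsDiskStable (boundedDegreeSymbolD κ (asanoContraction i₁ i₂)) := by
  rw [isDiskStable_boundedDegreeSymbolD_iff]
  intro z w hz hw
  rw [eval_asanoContraction_symbol h12 hκ₁ hκ₂]
  have hlt : ∀ {u : ℂ}, ‖u‖ < 1 → 1 + u ≠ 0 := fun {u} hu h => by
    have h2 : u = -1 := by linear_combination h
    rw [h2, norm_neg, norm_one] at hu
    exact lt_irrefl _ hu
  refine mul_ne_zero (hlt ?_) (prod_ne_zero_iff.2 fun j _ => pow_ne_zero _ (hlt ?_))
  · rw [norm_mul, norm_mul]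
    calc ‖z i₁‖ * ‖w i₁‖ * ‖w i₂‖ ≤ 1 * 1 * ‖w i₂‖ := by
          gcongr
          · exact (hz i₁).le
          · exact (hw i₁).le
      _ < 1 := by rw [one_mul, one_mul]; exact hw i₂
  · rw [norm_mul]
    calc ‖w j‖ * ‖z j‖ < 1 * 1 := mul_lt_mul'' (hw j) (hz j) (norm_nonneg _) (norm_nonneg _)
      _ = 1 := mul_one 1

/-- **Borcea–Brändén II, Lemma 8.8**: for `κ` with `κ_{i₁} = κ_{i₂} = 1` the Asano contraction maps `𝔻`-stable
polynomials of `ℂ_κ[z]` to `𝔻`-stable polynomials (Theorem 3.2 for `C = 𝔻` with the `𝔻`-stable symbol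
`(1+zw)^{(κ_3,…)}(1+z_1w_1w_2)`; `A(f) ≢ 0` since `A(f)(0,·) = f(0,0,·)`). [cite: BorceaBranden2009II, §8.3 Lemma 8.8] -/
theorem asano_contraction_diskStable {i₁ i₂ : σ} (h12 : i₁ ≠ i₂) {κ : σ → ℕ} (hκ₁ : κ i₁ = 1) (hκ₂ : κ i₂ = 1)
    {f : MvPolynomial σ ℂ} (hf : ∀ i, degreeOf i f ≤ κ i) (hs : IsDiskStable f) :
    IsDiskStable (asanoContraction i₁ i₂ f) := by
  rcases (BorceaBranden_diskStabilityPreserver_iff κ (asanoContraction i₁ i₂)).2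
      (Or.inr (isDiskStable_boundedDegreeSymbolD_asanoContraction h12 hκ₁ hκ₂)) f hf hs with h | h
  · exact h
  · exfalso
    -- `A(f)(0) = f(0) ≠ 0`
    have h0 := eval_asanoContraction h12 ((hf i₁).trans hκ₁.le) ((hf i₂).trans hκ₂.le) (fun _ => (0 : ℂ))
    rw [h, map_zero, zero_mul, add_zero] at h0
    refine hs (Function.update (Function.update (fun _ : σ => (0 : ℂ)) i₂ 0) i₁ 0) (fun i => ?_) h0.symm
    by_cases h1 : i = i₁
    · subst h1; rw [Function.update_self, norm_zero]; exact zero_lt_one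
    · rw [Function.update_of_ne h1]
      by_cases h2 : i = i₂
      · subst h2; rw [Function.update_self, norm_zero]; exact zero_lt_one
      · rw [Function.update_of_ne h2, norm_zero]; exact zero_lt_one

end Symbol

end Literature.Combinatorics.StablePolynomials

end
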